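import Literature.NumberTheory.LFunctions.ZeroGaps
import Literature.NumberTheory.LFunctions.ZeroStatisticsProofs
import Literature.NumberTheory.LFunctions.ZetaFirstZeroCertificate
import HarnessLib

/-!
# Selberg–Fujii: small gaps from large gaps (Titchmarsh §9.26, last paragraph) — proofs

Trunk T-ANT (`Literature/NumberTheory/LFunctions`). Proofs only (no definitions, no named facts).
Companion of `ZeroGaps.lean`, which records the two halves of the Selberg–Fujii theorem
(Titchmarsh–Heath-Brown §9.25, (9.25.5)–(9.25.6)) as the named facts
`Literature.NumberTheory.LFunctions.selberg_fujii_large_gaps` and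
`Literature.NumberTheory.LFunctions.selberg_fujii_small_gaps`.

## Main result

* `Literature.NumberTheory.LFunctions.selberg_fujii_small_gaps_of_large_gaps` —
  `selberg_fujii_large_gaps → selberg_fujii_small_gaps`: the last paragraph of Heath-Brown's
  proof sketch in Titchmarsh §9.26. Once a positive proportion of the normalised gaps
  `δ_n = (γ_{n+1} − γ_n)/(2π/log γ_n)` are `≥ λ > 1`, a positive proportion must be `≤ μ` for some
  `μ < 1`, because the normalised gaps have mean `≤ 1 + o(1)` (Riemann–von Mangoldt,
  `riemann_von_mangoldt_holds`). Hence the small-gap fact (9.25.6) reduces to the large-gap fact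
  (9.25.5) (essentially Titchmarsh (9.26.2)), whose proof is the genuinely deep part of §9.26
  (Fujii's moments (9.25.2)–(9.25.3) of `S(t + h) − S(t)` and the gap moments (9.25.4)).

## The proof

Write `N = N(T) = K + 1`, `J = {n < K}` (so `γ_n ≤ γ_K ≤ T` on `J`), `L_J = #{n ∈ J : δ_n ≥ λ}`,
`V_J = #{n ∈ J : δ_n ≤ μ}`, `μ = 1 − ν`.
* (`ZeroGapsProofs.sum_zetaNormalizedGap_le`) `δ_n ≤ (γ_{n+1} − γ_n) log T / 2π` on `J`, and the
  gaps telescope: `Σ_{n ∈ J} δ_n ≤ (log T / 2π)(γ_K − γ_0) ≤ (T/2π) log T`.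
* (`ZeroGapsProofs.eventually_mul_log_le`) Riemann–von Mangoldt: `(T/2π) log T ≤ (1 + ε) N(T)`
  for `T ≥ T(ε)`.
* Pointwise `δ_n ≥ μ + (λ − μ)·1[δ_n ≥ λ] − μ·1[δ_n ≤ μ]` (as `δ_n ≥ 0`, `μ ≤ λ`), so
  `Σ_J δ_n ≥ μ K + (λ − μ) L_J − μ V_J`.
* With `L_J ≥ A N − 1` and `ν = (λ − 1)A/4` this gives `(1 − ν) V_J ≥ 2ν N − λ ≥ ν N` as soon as
  `ν N(T) ≥ λ`, and `#{n < N : δ_n ≤ μ} ≥ V_J ≥ (1 − ν) V_J`.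
This is Titchmarsh's computation `T ≥ (2πμ/log T)(#U − #V − #S) + (2πλ/log T)#S + O(T/log T)`
run over `0 < γ_n ≤ T` instead of the window `T ≤ γ_n ≤ 2T` (the statements (9.25.5)–(9.25.6)
count `0 < γ_n ≤ T`).

## References

* E. C. Titchmarsh, *The Theory of the Riemann Zeta-Function*, 2nd ed. revised by
  D. R. Heath-Brown (1986), §9.25 (9.25.5)–(9.25.6) and §9.26 (last paragraph). [key `Titchmarsh1986`]
* A. Fujii, *On the difference between r consecutive ordinates of the zeros of the Riemann zeta
  function*, Proc. Japan Acad. 51 (1975), 741–743.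
-/

noncomputable section

open Real Filter Asymptotics
open scoped Topology

namespace Literature.NumberTheory.LFunctions

namespace ZeroGapsProofs

/-- Riemann–von Mangoldt in the crude one-sided form used here: for every `ε > 0`,
`(T/2π) log T ≤ (1 + ε) N(T)` for all large `T` (from `N(T) = (T/2π) log(T/2π) − T/2π + O(log T)`,
`riemann_von_mangoldt_holds`; Titchmarsh Thm. 9.4, and `#U = (T/2π) log T + O(T)` in §9.26).
[cite: Titchmarsh1986, Thm. 9.4] -/
theorem eventually_mul_log_le {ε : ℝ} (hε : 0 < ε) :
    ∀ᶠ T : ℝ in atTop, T / (2 * π) * Real.log T ≤ (1 + ε) * (zetaZeroCount T : ℝ) := by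
  obtain ⟨C₀, hC₀, hbd⟩ := riemann_von_mangoldt_holds.exists_pos
  set K₀ : ℝ := (1 + ε) * (Real.log (2 * π) + 1 + 2 * π * C₀) / ε with hK₀
  filter_upwards [hbd.bound, eventually_ge_atTop (1 : ℝ),
    Real.tendsto_log_atTop.eventually_ge_atTop K₀] with T hb h1 hK
  have hT0 : 0 < T := by linarith
  have hlogT : 0 ≤ Real.log T := Real.log_nonneg h1
  have hlog_le : Real.log T ≤ T := (Real.log_le_sub_one_of_pos hT0).trans (by linarith)
  rw [Real.norm_of_nonneg hlogT, Real.norm_eq_abs] at hb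
  have hlow := (abs_le.1 hb).1
  have hsplit : Real.log (T / (2 * π)) = Real.log T - Real.log (2 * π) :=
    Real.log_div hT0.ne' (by positivity)
  rw [hsplit] at hlow
  -- `N(T) ≥ (T/2π) log T − (T/2π)(log 2π + 1) − C₀ log T`, multiplied by `ε`
  have hlow' : ε * (T / (2 * π) * (Real.log T - Real.log (2 * π)) - T / (2 * π) - C₀ * Real.log T)
      ≤ ε * (zetaZeroCount T : ℝ) :=
    mul_le_mul_of_nonneg_left (by linarith) hε.le
  -- the lower-order terms are `≤ ε (T/2π) log T` once `log T ≥ K₀`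
  have hK' : ε * (T / (2 * π)) * K₀ ≤ ε * (T / (2 * π)) * Real.log T :=
    mul_le_mul_of_nonneg_left hK (by positivity)
  have hK₀' : ε * (T / (2 * π)) * K₀ =
      (1 + ε) * (T / (2 * π) * (Real.log (2 * π) + 1) + C₀ * T) := by
    rw [hK₀]
    field_simp
  have h7 : (1 + ε) * (C₀ * Real.log T) ≤ (1 + ε) * (C₀ * T) := by gcongr
  linarith

/-- Telescoping bound for the normalised gaps below height `T`: if `γ_K ≤ T` and `T ≥ 1` then
`Σ_{n<K} δ_n ≤ (T/2π) log T`, since `δ_n = (γ_{n+1} − γ_n) log γ_n / 2π ≤ (γ_{n+1} − γ_n) log T / 2π`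
for `n < K` (`0 < γ_n ≤ γ_K ≤ T`, ordinates non-decreasing) and `Σ_{n<K} (γ_{n+1} − γ_n) = γ_K − γ_0 ≤ T`
(Titchmarsh §9.26: `Σ_{n ∈ U} (γ_{n+1} − γ_n) = T + O(1)`). [cite: Titchmarsh1986, §9.26] -/
theorem sum_zetaNormalizedGap_le {K : ℕ} {T : ℝ} (hT : 1 ≤ T) (hK : zetaOrdinate K ≤ T) :
    ∑ n ∈ Finset.range K, zetaNormalizedGap n ≤ T / (2 * π) * Real.log T := by
  have hmono : Monotone zetaOrdinate := zetaOrdinate_mono_holds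
  have hpos : ∀ n, 0 < zetaOrdinate n := zetaOrdinate_pos_holds
  have hlogT : 0 ≤ Real.log T := Real.log_nonneg hT
  have hpt : ∀ n ∈ Finset.range K, zetaNormalizedGap n ≤
      Real.log T / (2 * π) * (zetaOrdinate (n + 1) - zetaOrdinate n) := by
    intro n hn
    rw [Finset.mem_range] at hn
    have hnT : zetaOrdinate n ≤ T := (hmono hn.le).trans hK
    have hgap : 0 ≤ zetaOrdinate (n + 1) - zetaOrdinate n := sub_nonneg.2 (hmono (Nat.le_succ n))
    have hlog : Real.log (zetaOrdinate n) ≤ Real.log T := Real.log_le_log (hpos n) hnT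
    rw [zetaNormalizedGap_eq_mul_div, div_le_iff₀ (by positivity : (0 : ℝ) < 2 * π)]
    calc (zetaOrdinate (n + 1) - zetaOrdinate n) * Real.log (zetaOrdinate n)
        ≤ (zetaOrdinate (n + 1) - zetaOrdinate n) * Real.log T :=
          mul_le_mul_of_nonneg_left hlog hgap
      _ = Real.log T / (2 * π) * (zetaOrdinate (n + 1) - zetaOrdinate n) * (2 * π) := by
          field_simp
  calc ∑ n ∈ Finset.range K, zetaNormalizedGap n
      ≤ ∑ n ∈ Finset.range K, Real.log T / (2 * π) * (zetaOrdinate (n + 1) - zetaOrdinate n) :=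
        Finset.sum_le_sum hpt
    _ = Real.log T / (2 * π) * (zetaOrdinate K - zetaOrdinate 0) := by
        rw [← Finset.mul_sum, Finset.sum_range_sub]
    _ ≤ Real.log T / (2 * π) * T := by
        apply mul_le_mul_of_nonneg_left _ (by positivity)
        linarith [hpos 0]
    _ = T / (2 * π) * Real.log T := by ring

/-- Dropping the last index costs at most one element of a filter of `Finset.range (K + 1)`.
[folklore] -/
theorem card_filter_range_succ_le (p : ℕ → Prop) [DecidablePred p] (K : ℕ) :
    ((Finset.range (K + 1)).filter p).card ≤ ((Finset.range K).filter p).card + 1 := by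
  rw [Finset.range_add_one, Finset.filter_insert]
  split_ifs
  · exact Finset.card_insert_le _ _
  · exact Nat.le_succ _

end ZeroGapsProofs

open ZeroGapsProofs in
/-- **Small gaps from large gaps** (Titchmarsh–Heath-Brown §9.26, last paragraph): the large-gap
half (9.25.5) of the Selberg–Fujii theorem implies the small-gap half (9.25.6). If `λ > 1`, `A > 0`
and `#{n < N(T) : δ_n ≥ λ} ≥ A N(T)` for `T ≥ T₀`, then with `ν = (λ − 1)A/4`, `μ = 1 − ν < 1`,
`#{n < N(T) : δ_n ≤ μ} ≥ ν N(T)` for all large `T`: the normalised gaps `δ_n`, `n < N(T) − 1`, sum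
to at most `(T/2π) log T ≤ (1 + ν) N(T)` (telescoping and Riemann–von Mangoldt), while each is
`≥ μ + (λ − μ)1[δ_n ≥ λ] − μ 1[δ_n ≤ μ]`. (In the source the count is over the window
`T ≤ γ_n ≤ 2T`; here, as in (9.25.5)–(9.25.6) themselves, over `0 < γ_n ≤ T`, i.e. `n < N(T)`.)
[cite: Titchmarsh1986, §9.26] -/
theorem selberg_fujii_small_gaps_of_large_gaps (h : selberg_fujii_large_gaps) :
    selberg_fujii_small_gaps := by
  obtain ⟨l, hl, A, hA, T₀, hT⟩ := h
  set ν : ℝ := (l - 1) * A / 4 with hν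
  have hν0 : 0 < ν := div_pos (mul_pos (by linarith) hA) four_pos
  refine ⟨1 - ν, by linarith, ν, hν0, ?_⟩
  have hN : ∀ᶠ T : ℝ in atTop, l / ν ≤ (zetaZeroCount T : ℝ) :=
    (tendsto_natCast_atTop_atTop.comp tendsto_zetaZeroCount_atTop_holds).eventually_ge_atTop _
  obtain ⟨T₁, hT₁⟩ := eventually_atTop.1 ((eventually_ge_atTop T₀).and
    ((eventually_ge_atTop (1 : ℝ)).and ((eventually_mul_log_le hν0).and hN)))
  refine ⟨T₁, fun T hTT ↦ ?_⟩
  obtain ⟨hT0, h1, hc, hd⟩ := hT₁ T hTT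
  have hLarge := hT T hT0
  rw [div_le_iff₀ hν0] at hd
  rcases (zetaZeroCount T).eq_zero_or_pos with h0 | hpos
  · simp [h0]
  obtain ⟨K, hK⟩ := Nat.exists_eq_succ_of_ne_zero hpos.ne'
  -- `γ_K ≤ T` since `K + 1 ≤ N(T)`
  have hKT : zetaOrdinate K ≤ T :=
    riemann_von_mangoldt_holds.zetaOrdinate_le_iff.2 (by omega)
  rw [hK] at hLarge hc hd ⊢
  push_cast at hLarge hc hd ⊢
  -- the players
  set δ : ℕ → ℝ := zetaNormalizedGap with hδ
  set LJ : ℕ := ((Finset.range K).filter fun n ↦ l ≤ δ n).card with hLJ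
  set VJ : ℕ := ((Finset.range K).filter fun n ↦ δ n ≤ 1 - ν).card with hVJ
  -- (1) upper bound for the sum of the gaps
  have hsum_le : ∑ n ∈ Finset.range K, δ n ≤ (1 + ν) * ((K : ℝ) + 1) :=
    (sum_zetaNormalizedGap_le h1 hKT).trans hc
  -- (2) lower bound for the sum of the gaps
  have h14 : (14 : ℝ) < zetaOrdinate 0 := fourteen_lt_zetaOrdinate_zero_holds
  have hmono : Monotone zetaOrdinate := zetaOrdinate_mono_holds
  have hpt : ∀ n ∈ Finset.range K,
      (1 - ν) + (l - (1 - ν)) * (if l ≤ δ n then 1 else 0) -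
        (1 - ν) * (if δ n ≤ 1 - ν then 1 else 0) ≤ δ n := by
    intro n _
    have hδ0 : 0 ≤ δ n :=
      zetaNormalizedGap_nonneg (hmono (Nat.le_succ n)) (by linarith [hmono (Nat.zero_le n)])
    split_ifs <;> linarith
  have hsum_ge := Finset.sum_le_sum hpt
  simp only [Finset.sum_sub_distrib, Finset.sum_add_distrib, ← Finset.mul_sum, Finset.sum_boole,
    Finset.sum_const, Finset.card_range, nsmul_eq_mul] at hsum_ge
  -- (3) the large-gap count loses at most one index when passing to `range K`
  have hLJ1 : (((Finset.range (K + 1)).filter fun n ↦ l ≤ δ n).card : ℝ) ≤ (LJ : ℝ) + 1 := by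
    exact_mod_cast card_filter_range_succ_le _ K
  -- (4) the small-gap count only grows when passing to `range (K + 1)`
  have hVJ1 : (VJ : ℝ) ≤ (((Finset.range (K + 1)).filter fun n ↦ δ n ≤ 1 - ν).card : ℝ) := by
    exact_mod_cast Finset.card_le_card
      (Finset.filter_subset_filter _ (Finset.range_mono (Nat.le_succ K)))
  -- (5) arithmetic
  have hA1 : A * ((K : ℝ) + 1) - 1 ≤ (LJ : ℝ) := by linarith
  have hmul : (l - (1 - ν)) * (A * ((K : ℝ) + 1) - 1) ≤ (l - (1 - ν)) * (LJ : ℝ) :=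
    mul_le_mul_of_nonneg_left hA1 (by linarith)
  have hνK : (l - 1) * A * ((K : ℝ) + 1) = 4 * ν * ((K : ℝ) + 1) := by
    rw [hν]; ring
  have hνA : 0 ≤ ν * A * ((K : ℝ) + 1) := by positivity
  have hνV : 0 ≤ ν * (VJ : ℝ) := by positivity
  linarith
    
end Literature.NumberTheory.LFunctions

end
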